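import Summits.AtomisticToContinuum.Crystallization.Theorems.ExcessDecayLiouvilleCoarseGrainsPinFromSeries
import HarnessLib

/-!
# Calculus of the shape functional: weighted term-wise differentiation and the abstract uniqueness lemma
(crux `SlackRigidity`, stmt-AtomisticToContinuum-11960, line `ekeland-surgery-parity`, numerics stub
`stub_hcpShapeUniqueMax` of the reshaped `stub_hcpOptimalCongruent`)

Two potential-free ingredients of the certificate "the shape functional `G = S₃²/S₆` of relaxed hcp has
at most one maximiser on the middle window":

* **weighted term-wise differentiation** of the `ℤ³`-indexed lattice sums in the layer ratio `y`:
  `(d/dy) ∑_{v ≠ 0} (k²)ᵐ (Q v + k²y²)⁻ᵉ = −2ey · ∑_{v ≠ 0} (k²)ᵐ⁺¹ (Q v + k²y²)⁻ᵉ⁻¹`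
  (`hcpW_hasDerivAt_tsum`; the case `m = 0` is the tree's `hcpPinC_hasDerivAt_tsum`), for any nonnegative
  form `Q` positive off the origin on the layer `k = 0`;
* the **abstract uniqueness lemma** (`isMaxOn_unique_of_fermat`): for differentiable `S₃, S₆ > 0` on
  `[a, b] ⊂ (0, ∞)` with `S₃' = −6x D₃`, `S₆' = −12x D₆`, if the Fermat function `F = S₆D₃ − S₃D₆` is
  strictly increasing then `G = S₃²/S₆` (whose derivative is `−12x S₃ F/S₆²`) has at most one maximiser on
  `[a, b]`; and `F` is strictly increasing as soon as `F' = x(14 S₃E₆ − 8 S₆E₃ − 6 D₃D₆) > 0`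
  (`fermat_strictMonoOn`, with `D₃' = −8x E₃`, `D₆' = −14x E₆`).

All `[folklore]` real analysis.
-/

noncomputable section

namespace Summit.AtomisticToContinuum.Crystallization.Theorems.EkelandSurgeryParityUniq

open Set
open Summit.AtomisticToContinuum.Crystallization.Theorems.ExcessDecayLiouvilleCoarseGrains

/-! ## Weighted term-wise differentiation -/

/-- Derivative of one weighted term `[v ≠ 0] (k²)ᵐ (Q v + k² y²)⁻ᵉ` in `y`. [folklore] -/
theorem hcpW_hasDerivAt_term (Q : ℤ × ℤ × ℤ → ℝ) (m e : ℕ) (v : ℤ × ℤ × ℤ) {y : ℝ}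
    (hy : v ≠ 0 → Q v + (v.1 : ℝ) ^ 2 * y ^ 2 ≠ 0) :
    HasDerivAt (fun y : ℝ => if v = 0 then (0 : ℝ) else
        ((v.1 : ℝ) ^ 2) ^ m * ((Q v + (v.1 : ℝ) ^ 2 * y ^ 2)⁻¹) ^ e)
      (-(2 * e * y) * (if v = 0 then (0 : ℝ) else
        ((v.1 : ℝ) ^ 2) ^ (m + 1) * ((Q v + (v.1 : ℝ) ^ 2 * y ^ 2)⁻¹) ^ (e + 1))) y := by
  by_cases hv : v = 0
  · simp only [hv, if_true, mul_zero]
    exact hasDerivAt_const _ _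
  · simp only [hv, if_false]
    have hp := hy hv
    have h1 : HasDerivAt (fun y : ℝ => Q v + (v.1 : ℝ) ^ 2 * y ^ 2)
        ((v.1 : ℝ) ^ 2 * (2 * y)) y := by
      simpa using ((hasDerivAt_pow 2 y).const_mul ((v.1 : ℝ) ^ 2)).const_add (Q v)
    refine (((h1.fun_inv hp).fun_pow e).const_mul (((v.1 : ℝ) ^ 2) ^ m)).congr_deriv ?_
    rcases e with _ | n
    · simp
    · rw [Nat.add_sub_cancel, Nat.cast_succ, div_eq_mul_inv, ← inv_pow, pow_succ ((v.1 : ℝ) ^ 2) m]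
      ring

/-- Uniform bound for the weighted termwise derivatives on `y ∈ (c/2, 2c)`. [folklore] -/
theorem hcpW_deriv_bound {Q : ℤ × ℤ × ℤ → ℝ} (hQ0 : ∀ v, 0 ≤ Q v)
    (hQ1 : ∀ v : ℤ × ℤ × ℤ, v ≠ 0 → v.1 = 0 → 0 < Q v) (m e : ℕ) {c y : ℝ} (hc : 0 < c)
    (hy : y ∈ Set.Ioo (c / 2) (2 * c)) (v : ℤ × ℤ × ℤ) :
    ‖-(2 * e * y) * (if v = 0 then (0 : ℝ) else
        ((v.1 : ℝ) ^ 2) ^ (m + 1) * ((Q v + (v.1 : ℝ) ^ 2 * y ^ 2)⁻¹) ^ (e + 1))‖ ≤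
      16 * e / c * (if v = 0 then (0 : ℝ) else
        ((v.1 : ℝ) ^ 2) ^ m * ((Q v + (v.1 : ℝ) ^ 2 * (c / 2) ^ 2)⁻¹) ^ e) := by
  by_cases hv : v = 0
  · simp [hv]
  · simp only [hv, if_false]
    have hy0 : 0 < y := lt_trans (half_pos hc) hy.1
    have hQv := hQ0 v
    have hp0 : 0 < Q v + (v.1 : ℝ) ^ 2 * (c / 2) ^ 2 := hcpPinC_p_pos hQ0 hQ1 hv (half_pos hc).ne'
    have hpy : Q v + (v.1 : ℝ) ^ 2 * (c / 2) ^ 2 ≤ Q v + (v.1 : ℝ) ^ 2 * y ^ 2 := by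
      gcongr; exact hy.1.le
    have hpy0 : 0 < Q v + (v.1 : ℝ) ^ 2 * y ^ 2 := hp0.trans_le hpy
    have hk : (v.1 : ℝ) ^ 2 * (Q v + (v.1 : ℝ) ^ 2 * y ^ 2)⁻¹ ≤ (y ^ 2)⁻¹ := by
      rw [← div_eq_mul_inv, ← one_div, div_le_div_iff₀ hpy0 (by positivity)]
      nlinarith
    have hkm : 0 ≤ ((v.1 : ℝ) ^ 2) ^ m := by positivity
    rw [Real.norm_eq_abs, abs_mul, abs_neg, abs_of_nonneg (by positivity),
      abs_of_nonneg (by positivity)]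
    calc 2 * e * y * (((v.1 : ℝ) ^ 2) ^ (m + 1) * ((Q v + (v.1 : ℝ) ^ 2 * y ^ 2)⁻¹) ^ (e + 1))
        = 2 * e * y * (((v.1 : ℝ) ^ 2 * (Q v + (v.1 : ℝ) ^ 2 * y ^ 2)⁻¹) *
            (((v.1 : ℝ) ^ 2) ^ m * ((Q v + (v.1 : ℝ) ^ 2 * y ^ 2)⁻¹) ^ e)) := by ring
      _ ≤ 2 * e * (2 * c) * ((y ^ 2)⁻¹ *
            (((v.1 : ℝ) ^ 2) ^ m * ((Q v + (v.1 : ℝ) ^ 2 * (c / 2) ^ 2)⁻¹) ^ e)) := by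
          gcongr
          · exact hy.2.le
      _ ≤ 2 * e * (2 * c) * (((c / 2) ^ 2)⁻¹ *
            (((v.1 : ℝ) ^ 2) ^ m * ((Q v + (v.1 : ℝ) ^ 2 * (c / 2) ^ 2)⁻¹) ^ e)) := by
          gcongr
          exact hy.1.le
      _ = 16 * e / c * (((v.1 : ℝ) ^ 2) ^ m * ((Q v + (v.1 : ℝ) ^ 2 * (c / 2) ^ 2)⁻¹) ^ e) := by
          field_simp
          ring

/-- **Weighted term-wise differentiation in the layer ratio**:
`(d/dy) ∑_{v ≠ 0} (k²)ᵐ (Q v + k²y²)⁻ᵉ = −2ec · ∑_{v ≠ 0} (k²)ᵐ⁺¹ (Q v + k²c²)⁻ᵉ⁻¹` at `y = c > 0`,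
granted summability of the weighted family at `c/2` and at `c`. [folklore] -/
theorem hcpW_hasDerivAt_tsum {Q : ℤ × ℤ × ℤ → ℝ} (hQ0 : ∀ v, 0 ≤ Q v)
    (hQ1 : ∀ v : ℤ × ℤ × ℤ, v ≠ 0 → v.1 = 0 → 0 < Q v) (m e : ℕ) {c : ℝ} (hc : 0 < c)
    (hhalf : Summable fun v : ℤ × ℤ × ℤ =>
      if v = 0 then (0 : ℝ) else ((v.1 : ℝ) ^ 2) ^ m * ((Q v + (v.1 : ℝ) ^ 2 * (c / 2) ^ 2)⁻¹) ^ e)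
    (hcs : Summable fun v : ℤ × ℤ × ℤ =>
      if v = 0 then (0 : ℝ) else ((v.1 : ℝ) ^ 2) ^ m * ((Q v + (v.1 : ℝ) ^ 2 * c ^ 2)⁻¹) ^ e) :
    HasDerivAt (fun y : ℝ => ∑' v : ℤ × ℤ × ℤ,
        if v = 0 then (0 : ℝ) else ((v.1 : ℝ) ^ 2) ^ m * ((Q v + (v.1 : ℝ) ^ 2 * y ^ 2)⁻¹) ^ e)
      (-(2 * e * c) * ∑' v : ℤ × ℤ × ℤ,
        if v = 0 then (0 : ℝ) else
          ((v.1 : ℝ) ^ 2) ^ (m + 1) * ((Q v + (v.1 : ℝ) ^ 2 * c ^ 2)⁻¹) ^ (e + 1)) c := by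
  have hmem : c ∈ Set.Ioo (c / 2) (2 * c) := ⟨by linarith, by linarith⟩
  refine (hasDerivAt_tsum_of_isPreconnected (t := Set.Ioo (c / 2) (2 * c))
    (hhalf.mul_left (16 * e / c)) isOpen_Ioo isPreconnected_Ioo
    (fun v y hy => hcpW_hasDerivAt_term Q m e v fun hv =>
      (hcpPinC_p_pos hQ0 hQ1 hv (lt_trans (half_pos hc) hy.1).ne').ne')
    (fun v y hy => hcpW_deriv_bound hQ0 hQ1 m e hc hy v) hmem hcs hmem).congr_deriv ?_
  exact tsum_mul_left

/-! ## The abstract uniqueness lemma -/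

/-- Derivative of the shape functional `G = S₃²/S₆`: `G' = 12x S₃ (S₃D₆ − S₆D₃)/S₆²`. [folklore] -/
theorem shapeG_hasDerivAt {S₃ S₆ D₃ D₆ : ℝ → ℝ} {x : ℝ}
    (h3 : HasDerivAt S₃ (-(2 * 3 * x) * D₃ x) x) (h6 : HasDerivAt S₆ (-(2 * 6 * x) * D₆ x) x)
    (hS₆ : S₆ x ≠ 0) :
    HasDerivAt (fun t => S₃ t ^ 2 / S₆ t)
      (12 * x * S₃ x * (S₃ x * D₆ x - S₆ x * D₃ x) / S₆ x ^ 2) x := by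
  have h := (h3.pow 2).div h6 hS₆
  refine h.congr_deriv ?_
  simp only [Nat.cast_ofNat, Nat.add_one_sub_one, pow_one, Pi.pow_apply]
  ring

/-- **Abstract uniqueness of the maximiser.**  On `[a, b]` with `0 < a`, let `S₃, S₆ > 0` be
differentiable with `S₃' = −6x D₃`, `S₆' = −12x D₆`, and let the Fermat function `F = S₆D₃ − S₃D₆` be
strictly increasing on `[a, b]`.  Then `G = S₃²/S₆` has at most one maximiser on `[a, b]`: between two
maximisers `c < c'`, the midpoint `m` has either `F(m) > 0` (then `G` strictly decreases on `[m, c']`,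
contradicting maximality at `c'`) or `F(m) ≤ 0` (then `G` strictly increases on `[c, m]`, contradicting
maximality at `c`). [folklore] -/
theorem isMaxOn_unique_of_fermat {a b : ℝ} (ha : 0 < a) {S₃ S₆ D₃ D₆ : ℝ → ℝ}
    (h3 : ∀ x ∈ Icc a b, HasDerivAt S₃ (-(2 * 3 * x) * D₃ x) x)
    (h6 : ∀ x ∈ Icc a b, HasDerivAt S₆ (-(2 * 6 * x) * D₆ x) x)
    (hS₃ : ∀ x ∈ Icc a b, 0 < S₃ x) (hS₆ : ∀ x ∈ Icc a b, 0 < S₆ x)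
    (hF : StrictMonoOn (fun x => S₆ x * D₃ x - S₃ x * D₆ x) (Icc a b)) :
    ∀ c c' : ℝ, c ∈ Icc a b → c' ∈ Icc a b →
      IsMaxOn (fun x => S₃ x ^ 2 / S₆ x) (Icc a b) c →
      IsMaxOn (fun x => S₃ x ^ 2 / S₆ x) (Icc a b) c' → c = c' := by
  set G : ℝ → ℝ := fun x => S₃ x ^ 2 / S₆ x with hG
  set F : ℝ → ℝ := fun x => S₆ x * D₃ x - S₃ x * D₆ x with hFdef
  -- derivative of `G` on `[a, b]`
  have hGd : ∀ x ∈ Icc a b, HasDerivAt G (12 * x * S₃ x * (S₃ x * D₆ x - S₆ x * D₃ x) / S₆ x ^ 2) x :=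
    fun x hx => shapeG_hasDerivAt (h3 x hx) (h6 x hx) (hS₆ x hx).ne'
  have hGcont : ∀ {u v : ℝ}, Icc u v ⊆ Icc a b → ContinuousOn G (Icc u v) := fun hsub =>
    fun x hx => (hGd x (hsub hx)).continuousAt.continuousWithinAt
  have hGderiv : ∀ x ∈ Icc a b, deriv G x = 12 * x * S₃ x * (-(F x)) / S₆ x ^ 2 := by
    intro x hx
    rw [(hGd x hx).deriv, hFdef]
    ring
  -- `G` strictly increases where `F < 0`, strictly decreases where `F > 0`
  have hmono : ∀ {u v : ℝ}, Icc u v ⊆ Icc a b → (∀ x ∈ Ioo u v, F x < 0) → StrictMonoOn G (Icc u v) := by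
    intro u v hsub hneg
    refine strictMonoOn_of_deriv_pos (convex_Icc u v) (hGcont hsub) fun x hx => ?_
    rw [interior_Icc] at hx
    have hx' : x ∈ Icc a b := hsub (Ioo_subset_Icc_self hx)
    have hxpos : 0 < x := lt_of_lt_of_le ha hx'.1
    rw [hGderiv x hx']
    have := hneg x hx
    have h3' := hS₃ x hx'
    have h6' := hS₆ x hx'
    apply div_pos _ (by positivity)
    have : 0 < -(F x) := by linarith
    positivity
  have hanti : ∀ {u v : ℝ}, Icc u v ⊆ Icc a b → (∀ x ∈ Ioo u v, 0 < F x) → StrictAntiOn G (Icc u v) := by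
    intro u v hsub hposF
    refine strictAntiOn_of_deriv_neg (convex_Icc u v) (hGcont hsub) fun x hx => ?_
    rw [interior_Icc] at hx
    have hx' : x ∈ Icc a b := hsub (Ioo_subset_Icc_self hx)
    have hxpos : 0 < x := lt_of_lt_of_le ha hx'.1
    rw [hGderiv x hx']
    have := hposF x hx
    have h3' := hS₃ x hx'
    have h6' := hS₆ x hx'
    apply div_neg_of_neg_of_pos _ (by positivity)
    have h12 : 0 < 12 * x * S₃ x := by positivity
    nlinarith
  -- the ordered case
  have key : ∀ c c' : ℝ, c ∈ Icc a b → c' ∈ Icc a b → c < c' →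
      IsMaxOn G (Icc a b) c → IsMaxOn G (Icc a b) c' → False := by
    intro c c' hc hc' hlt hmax hmax'
    set m := (c + c') / 2 with hm
    have hcm : c < m := by rw [hm]; linarith
    have hmc' : m < c' := by rw [hm]; linarith
    have hmI : m ∈ Icc a b := ⟨by linarith [hc.1], by linarith [hc'.2]⟩
    have hsub1 : Icc c m ⊆ Icc a b := fun x hx => ⟨le_trans hc.1 hx.1, le_trans hx.2 hmI.2⟩
    have hsub2 : Icc m c' ⊆ Icc a b := fun x hx => ⟨le_trans hmI.1 hx.1, le_trans hx.2 hc'.2⟩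
    by_cases hFm : 0 < F m
    · -- `F > 0` on `(m, c')`: `G` strictly decreasing on `[m, c']`, contradicting the maximum at `c'`
      have hposF : ∀ x ∈ Ioo m c', 0 < F x := fun x hx =>
        hFm.trans (hF hmI (hsub2 (Ioo_subset_Icc_self hx)) hx.1)
      have h1 : G c' < G m :=
        hanti hsub2 hposF (left_mem_Icc.2 hmc'.le) (right_mem_Icc.2 hmc'.le) hmc'
      have h2 : G m ≤ G c' := hmax' hmI
      linarith
    · -- `F ≤ 0` at `m`, so `F < 0` on `(c, m)`: `G` strictly increasing on `[c, m]`, contradicting the maximum at `c`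
      push Not at hFm
      have hneg : ∀ x ∈ Ioo c m, F x < 0 := fun x hx =>
        lt_of_lt_of_le (hF (hsub1 (Ioo_subset_Icc_self hx)) hmI hx.2) hFm
      have h1 : G c < G m :=
        hmono hsub1 hneg (left_mem_Icc.2 hcm.le) (right_mem_Icc.2 hcm.le) hcm
      have h2 : G m ≤ G c := hmax hmI
      linarith
  intro c c' hc hc' hmax hmax'
  rcases lt_trichotomy c c' with hlt | heq | hgt
  · exact (key c c' hc hc' hlt hmax hmax').elim
  · exact heq
  · exact (key c' c hc' hc hgt hmax' hmax).elim

/-- **Strict monotonicity of the Fermat function from `F' > 0`.**  With `S₃' = −6x D₃`, `S₆' = −12x D₆`,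
`D₃' = −8x E₃`, `D₆' = −14x E₆` on `[a, b] ⊂ (0, ∞)`, the Fermat function `F = S₆D₃ − S₃D₆` has
`F' = x (14 S₃E₆ − 8 S₆E₃ − 6 D₃D₆)`, so positivity of the bracket makes `F` strictly increasing. [folklore] -/
theorem fermat_strictMonoOn {a b : ℝ} (ha : 0 < a) {S₃ S₆ D₃ D₆ E₃ E₆ : ℝ → ℝ}
    (h3 : ∀ x ∈ Icc a b, HasDerivAt S₃ (-(2 * 3 * x) * D₃ x) x)
    (h6 : ∀ x ∈ Icc a b, HasDerivAt S₆ (-(2 * 6 * x) * D₆ x) x)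
    (hd3 : ∀ x ∈ Icc a b, HasDerivAt D₃ (-(2 * 4 * x) * E₃ x) x)
    (hd6 : ∀ x ∈ Icc a b, HasDerivAt D₆ (-(2 * 7 * x) * E₆ x) x)
    (hpos : ∀ x ∈ Icc a b, 0 < 14 * S₃ x * E₆ x - 8 * S₆ x * E₃ x - 6 * D₃ x * D₆ x) :
    StrictMonoOn (fun x => S₆ x * D₃ x - S₃ x * D₆ x) (Icc a b) := by
  have hFd : ∀ x ∈ Icc a b, HasDerivAt (fun x => S₆ x * D₃ x - S₃ x * D₆ x)
      (x * (14 * S₃ x * E₆ x - 8 * S₆ x * E₃ x - 6 * D₃ x * D₆ x)) x := by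
    intro x hx
    have h := ((h6 x hx).mul (hd3 x hx)).sub ((h3 x hx).mul (hd6 x hx))
    refine h.congr_deriv ?_
    ring
  refine strictMonoOn_of_deriv_pos (convex_Icc a b)
    (fun x hx => (hFd x hx).continuousAt.continuousWithinAt) fun x hx => ?_
  rw [interior_Icc] at hx
  have hx' : x ∈ Icc a b := Ioo_subset_Icc_self hx
  rw [(hFd x hx').deriv]
  exact mul_pos (lt_of_lt_of_le ha hx'.1) (hpos x hx')

/-- Anchor (registered sub-goal `uniqCalculus_anchor` of stmt-AtomisticToContinuum-11960): derivative of
the shape functional. [folklore] -/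
theorem uniqCalculus_anchor :
    ∀ (S₃ S₆ D₃ D₆ : ℝ → ℝ) (x : ℝ), HasDerivAt S₃ (-(2 * 3 * x) * D₃ x) x → HasDerivAt S₆ (-(2 * 6 * x) * D₆ x) x → S₆ x ≠ 0 → HasDerivAt (fun t => S₃ t ^ 2 / S₆ t) (12 * x * S₃ x * (S₃ x * D₆ x - S₆ x * D₃ x) / S₆ x ^ 2) x :=
  fun _ _ _ _ _ h3 h6 hS₆ => shapeG_hasDerivAt h3 h6 hS₆

end Summit.AtomisticToContinuum.Crystallization.Theorems.EkelandSurgeryParityUniq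

end
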